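import Summits.Ventures.LatticeQCDFlow.Exactness.IMHStickingFloorAllLags
import HarnessLib

/-!
# Layer-cake form of EVERY autocovariance of the flow sampler and of its partial Green–Kubo sums

HONEST FRAMING: exact (Metropolis-corrected) sampling algorithms for lattice gauge theory;
figures of merit are autocorrelation/cost numbers at stated couplings and volumes; no
continuum-physics claim.  (SCALAR calibration rung S0-A: not a gauge result.)

Venture `LatticeQCDFlow` (cell pub-lqcd), topic `Exactness`; FANOUT row 2 (`s0-phi4`, FLOW arm:
normalizing-flow proposals + independence-Metropolis accept/reject).  NEW WORK of the cell,
composing the cell's Smith–Tierney theorem (`IMHSmithTierney.lean`: the exact `n`-step law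
`(Kⁿ⁺¹ g)(x) = ∫ T_{n+1}(b(x) ∨ b(z)) g(z) w(z) dμ + λ(b(x))^{n+1} g(x)`) with the layer cake of
`IMHStickingFloorAllLags.lean` (`∫∫ T_{n+1}(b ∨ b') g w g' w' = ∫_{u>0} φₙ(u) G(u)² du`).
Nothing is cited as a fact; Smith–Tierney 1996 / Wang arXiv:2008.02455 Thm 5 are NAMED ONLY.

## What is proved (`w, q > 0` measurable integrable, `∫ q dμ = 1`, `b = w/q`, `K = imhOp μ w q`,
`λ = rejCurve μ w q`, `φₙ(u) = (n+1)λ(u)ⁿ/u²`, `G(u) = ∫ 1[b < u] g w dμ`, `Π(u⁻) = massBelow`,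
`Z = ∫ w dμ`; `g` bounded measurable, `C(n) = ∫ g (Kⁿ g) w dμ`)

* `integral_pos_of_pos`, **`rejCurve_lt_one`** — `λ(v) < 1` for every `v > 0` (a proposal is
  accepted with positive probability from every state);
* `massBelow_le_self` (`Π(u⁻) ≤ u`), `abs_levelFun_le` (`|G(u)| ≤ B Π(u⁻)`),
  `measurable_levelFun`;
* `integrable_prod_stKernel_form` — the Smith–Tierney form is in `L¹(μ ⊗ μ)`;
* **`autocov_succ_eq_layerCake`** — for every `n`:
  `C(n+1) = ∫_{u>0} φₙ(u) G(u)² du + ∫ g² w λ(b)^{n+1} dμ`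
  (an absolutely continuous part, diagonal in the weight level `u`, plus the sticking atom);
* `integrableOn_stIntegrand_mul_sq` — `φₙ G²` is integrable on `(0, ∞)`
  (`≤ (n+1)B²` on `(0, Z]`, `≤ φₙ B² Z²` on `(Z, ∞)`);
* **`autocov_partialSum_eq_layerCake`** — for every `N`:
  `Σ_{k<N} C(k+1) = ∫_{u>0} (Σ_{k<N} (k+1)λ(u)ᵏ)/u² · G(u)² du + ∫ g² w Σ_{k<N} λ(b)^{k+1} dμ`.

The `N → ∞` limit — the EXACT integrated autocorrelation time of the flow sampler as a functional
of the joint target law of `(g, b)` alone,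
`τ_int = ½ + [∫_{u>0} G(u)²/(u(1 − λ(u)))² du + ∫ g² w λ(b)/(1 − λ(b)) dμ] / ∫ g² w dμ` —
is `Exactness/IMHTauIntExact.lean`.  Relation to the tree: row 8's `Scoring/IMHGreenKubo.lean` is
the finite-state windowless law via the Poisson equation; here general state space, closed form.
NOT CLAIMED: anything for HMC / local Metropolis; unbounded observables; any number for a trained
network.
-/

namespace Summit.Ventures.LatticeQCDFlow.Exactness

open Real MeasureTheory Filter Set Topology
open Summit.Ventures.LatticeQCDFlow.Scoring

variable {X : Type*} [MeasurableSpace X] {μ : Measure X} {w q : X → ℝ}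

variable [SFinite μ]

/-! ## `λ < 1`, level functionals -/

omit [SFinite μ] in
/-- A pointwise positive integrable function has positive integral: `∫ q dμ = 1` certifies
`μ ≠ 0`. -/
theorem integral_pos_of_pos {f : X → ℝ} (hf0 : ∀ t, 0 < f t) (hfi : Integrable f μ)
    (hq1 : ∫ z, q z ∂μ = 1) : 0 < ∫ z, f z ∂μ := by
  have hsupp : Function.support f = univ := Set.eq_univ_of_forall fun z => (hf0 z).ne'
  rw [integral_pos_iff_support_of_nonneg (fun z => (hf0 z).le) hfi, hsupp]
  have hμ : μ ≠ 0 := by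
    intro h
    rw [h, integral_zero_measure] at hq1
    exact zero_ne_one hq1
  exact Measure.measure_univ_pos.2 hμ

omit [SFinite μ] in
/-- **`λ(v) < 1` for every `v > 0`**: from any state a proposal is accepted with positive
probability, `1 − λ(v) = ∫ min(1, b/v) q dμ > 0`. -/
theorem rejCurve_lt_one (hw0 : ∀ t, 0 < w t) (hwm : Measurable w) (hq0 : ∀ t, 0 < q t)
    (hqm : Measurable q) (hqi : Integrable q μ) (hq1 : ∫ z, q z ∂μ = 1) {v : ℝ} (hv : 0 < v) :
    rejCurve μ w q v < 1 := by
  have hint := integrable_rejCurve_integrand hw0 hwm hq0 hqm hqi hv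
  have hf0 : ∀ z, 0 < min 1 (w z / q z / v) * q z := fun z =>
    mul_pos (lt_min one_pos (div_pos (div_pos (hw0 z) (hq0 z)) hv)) (hq0 z)
  have hfi : Integrable (fun z => min 1 (w z / q z / v) * q z) μ := by
    refine (hqi.sub hint).congr (Eventually.of_forall fun z => ?_)
    show q z - (1 - min 1 (w z / q z / v)) * q z = min 1 (w z / q z / v) * q z
    ring
  have e : ∫ z, min 1 (w z / q z / v) * q z ∂μ
      = (∫ z, q z ∂μ) - ∫ z, (1 - min 1 (w z / q z / v)) * q z ∂μ := by
    rw [← integral_sub hqi hint]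
    refine integral_congr_ae (Eventually.of_forall fun z => ?_)
    show min 1 (w z / q z / v) * q z = q z - (1 - min 1 (w z / q z / v)) * q z
    ring
  have hsub : 1 - rejCurve μ w q v = ∫ z, min 1 (w z / q z / v) * q z ∂μ := by
    unfold rejCurve
    rw [e, hq1]
  have hpos : 0 < ∫ z, min 1 (w z / q z / v) * q z ∂μ := integral_pos_of_pos hf0 hfi hq1
  linarith

omit [SFinite μ] in
/-- **`Π(u⁻) ≤ u`** (`u ≥ 0`, `∫ q = 1`): on `{b < u}` one has `w = b q < u q`. -/
theorem massBelow_le_self (hw0 : ∀ t, 0 < w t) (hwm : Measurable w) (hwi : Integrable w μ)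
    (hq0 : ∀ t, 0 < q t) (hqm : Measurable q) (hqi : Integrable q μ) (hq1 : ∫ z, q z ∂μ = 1)
    {u : ℝ} (hu : 0 ≤ u) : massBelow μ w q u ≤ u := by
  obtain ⟨iB, -⟩ := integrable_mass_integrands hw0 hwm hwi hqm u
  unfold massBelow
  calc ∫ z, (if w z / q z < u then w z else 0) ∂μ ≤ ∫ z, u * q z ∂μ := by
        refine integral_mono iB (hqi.const_mul u) fun z => ?_
        show (if w z / q z < u then w z else 0) ≤ u * q z
        split_ifs with h
        · exact ((div_lt_iff₀ (hq0 z)).1 h).le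
        · exact mul_nonneg hu (hq0 z).le
    _ = u := by rw [integral_const_mul, hq1, mul_one]

omit [SFinite μ] in
/-- **`|G(u)| ≤ B Π(u⁻)`**: the level functional `G(u) = ∫ 1[b < u] g w dμ` of an observable
bounded by `B`. -/
theorem abs_levelFun_le (hw0 : ∀ t, 0 < w t) (hwm : Measurable w) (hwi : Integrable w μ)
    (hqm : Measurable q) {g : X → ℝ} {B : ℝ} (hgb : ∀ t, |g t| ≤ B) (u : ℝ) :
    |∫ x, (if w x / q x < u then g x * w x else 0) ∂μ| ≤ B * massBelow μ w q u := by
  obtain ⟨iB, -⟩ := integrable_mass_integrands hw0 hwm hwi hqm u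
  have hpt : ∀ x, |(if w x / q x < u then g x * w x else 0 : ℝ)|
      ≤ B * (if w x / q x < u then w x else 0) := by
    intro x
    split_ifs
    · rw [abs_mul, abs_of_pos (hw0 x)]
      exact mul_le_mul_of_nonneg_right (hgb x) (hw0 x).le
    · rw [abs_zero, mul_zero]
  unfold massBelow
  rw [← integral_const_mul]
  refine abs_integral_le_integral_abs.trans ?_
  exact integral_mono_of_nonneg (Eventually.of_forall fun x => abs_nonneg _) (iB.const_mul B)
    (Eventually.of_forall hpt)

/-- `u ↦ G(u)` is measurable (Fubini measurability of a jointly measurable integrand). -/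
theorem measurable_levelFun (hwm : Measurable w) (hqm : Measurable q) {g : X → ℝ}
    (hgm : Measurable g) :
    Measurable fun u : ℝ => ∫ x, (if w x / q x < u then g x * w x else 0) ∂μ := by
  have hF : Measurable fun p : ℝ × X => (if w p.2 / q p.2 < p.1 then g p.2 * w p.2 else 0 : ℝ) :=
    Measurable.ite (measurableSet_lt ((hwm.div hqm).comp measurable_snd) measurable_fst)
      ((hgm.mul hwm).comp measurable_snd) measurable_const
  exact (hF.stronglyMeasurable.integral_prod_right' (ν := μ)).measurable

/-! ## The layer-cake form of `C(n+1)` -/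

omit [SFinite μ] in
/-- The Smith–Tierney form `T_{n+1}(b(x) ∨ b(y)) g(y) w(y) g(x) w(x)` is in `L¹(μ ⊗ μ)`
(dominated by `(n+1) B² · w ⊗ q`, since `T_{n+1}(b(x) ∨ b(y)) ≤ (n+1)/b(y)`). -/
theorem integrable_prod_stKernel_form (hw0 : ∀ t, 0 < w t) (hwm : Measurable w)
    (hwi : Integrable w μ) (hq0 : ∀ t, 0 < q t) (hqm : Measurable q) (hqi : Integrable q μ)
    (hq1 : ∫ z, q z ∂μ = 1) (n : ℕ) {g : X → ℝ} (hgm : Measurable g) {B : ℝ}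
    (hgb : ∀ t, |g t| ≤ B) [SFinite μ] :
    Integrable (Function.uncurry fun (x y : X) =>
      stKernel μ w q n (max (w x / q x) (w y / q y)) * g y * w y * (g x * w x)) (μ.prod μ) := by
  have hb0 : ∀ t, 0 < w t / q t := fun t => div_pos (hw0 t) (hq0 t)
  have hbm : Measurable fun t => w t / q t := hwm.div hqm
  have hSb : ∀ v, 0 < v → 0 ≤ stKernel μ w q n v ∧ stKernel μ w q n v ≤ ((n : ℝ) + 1) / v :=
    fun v hv => stKernel_bounds hw0 hwm hq0 hqm hqi hq1 n hv
  have hmeas : Measurable (Function.uncurry fun (x y : X) =>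
      stKernel μ w q n (max (w x / q x) (w y / q y)) * g y * w y * (g x * w x)) :=
    ((((measurable_stKernel hwm hqm n).comp ((hbm.comp measurable_fst).max
      (hbm.comp measurable_snd))).mul (hgm.comp measurable_snd)).mul (hwm.comp measurable_snd)).mul
      ((hgm.comp measurable_fst).mul (hwm.comp measurable_fst))
  have hG : Integrable (fun p : X × X => w p.1 * ((((n : ℝ) + 1) * B * B) * q p.2)) (μ.prod μ) :=
    hwi.mul_prod (hqi.const_mul _)
  refine Integrable.mono' hG hmeas.aestronglyMeasurable (Eventually.of_forall fun p => ?_)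
  have hB : 0 ≤ B := (abs_nonneg _).trans (hgb p.1)
  have hm : 0 < max (w p.1 / q p.1) (w p.2 / q p.2) := lt_max_of_lt_left (hb0 p.1)
  obtain ⟨hS0, hS1⟩ := hSb _ hm
  have hS2 : stKernel μ w q n (max (w p.1 / q p.1) (w p.2 / q p.2))
      ≤ ((n : ℝ) + 1) / (w p.2 / q p.2) :=
    hS1.trans (div_le_div_of_nonneg_left (by positivity) (hb0 p.2) (le_max_right _ _))
  rw [Real.norm_eq_abs]
  show |stKernel μ w q n (max (w p.1 / q p.1) (w p.2 / q p.2)) * g p.2 * w p.2 * (g p.1 * w p.1)|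
    ≤ w p.1 * ((((n : ℝ) + 1) * B * B) * q p.2)
  rw [abs_mul, abs_mul, abs_mul, abs_mul, abs_of_nonneg hS0, abs_of_pos (hw0 p.2),
    abs_of_pos (hw0 p.1)]
  have hq2 := (hq0 p.2).ne'
  have hw2 := hw0 p.2
  calc stKernel μ w q n (max (w p.1 / q p.1) (w p.2 / q p.2)) * |g p.2| * w p.2 * (|g p.1| * w p.1)
      ≤ ((n : ℝ) + 1) / (w p.2 / q p.2) * B * w p.2 * (B * w p.1) :=
        mul_le_mul (mul_le_mul_of_nonneg_right (mul_le_mul hS2 (hgb _) (abs_nonneg _)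
          (div_nonneg (by positivity) (hb0 p.2).le)) hw2.le)
          (mul_le_mul_of_nonneg_right (hgb _) (hw0 _).le) (mul_nonneg (abs_nonneg _) (hw0 _).le)
          (mul_nonneg (mul_nonneg (div_nonneg (by positivity) (hb0 p.2).le) hB) hw2.le)
    _ = w p.1 * ((((n : ℝ) + 1) * B * B) * q p.2) := by
        field_simp

omit [SFinite μ] in
/-- `g² w h ∈ L¹(μ)` for bounded measurable `g` and measurable `0 ≤ h ≤ 1`. -/
theorem integrable_sq_mul_weight_mul (hw0 : ∀ t, 0 < w t) (hwm : Measurable w)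
    (hwi : Integrable w μ) {g h : X → ℝ} (hgm : Measurable g) (hhm : Measurable h) {B : ℝ}
    (hgb : ∀ t, |g t| ≤ B) (hh0 : ∀ t, 0 ≤ h t) (hh1 : ∀ t, h t ≤ 1) :
    Integrable (fun x => g x ^ 2 * w x * h x) μ := by
  have hg2b : ∀ t, |g t ^ 2| ≤ B ^ 2 := fun t => by
    rw [abs_pow]; exact pow_le_pow_left₀ (abs_nonneg _) (hgb t) 2
  have hhb : ∀ t, |h t| ≤ 1 := fun t => by rw [abs_of_nonneg (hh0 t)]; exact hh1 t
  exact (integrable_mul_mul_weight hw0 hwm hwi (hgm.pow_const 2) hhm hg2b hhb).congr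
    (Eventually.of_forall fun x => mul_right_comm _ _ _)

/-- **LAYER-CAKE FORM OF EVERY AUTOCOVARIANCE OF THE EXACT FLOW SAMPLER.**  `w, q > 0`
measurable integrable, `∫ q = 1`, `b = w/q`, `λ` the rejection curve, `g` bounded measurable (no
centring needed).  For every `n`:
`∫ g (Kⁿ⁺¹ g) w dμ = ∫_{u>0} (n+1)λ(u)ⁿ/u² · (∫ 1[b < u] g w dμ)² du + ∫ g² w λ(b)^{n+1} dμ`
— the off-diagonal part of the `(n+1)`-step law contributes a positive layer cake over weight
levels `u`, the atom (all `n+1` proposals rejected) contributes the sticking term. -/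
theorem autocov_succ_eq_layerCake (hw0 : ∀ t, 0 < w t) (hwm : Measurable w)
    (hwi : Integrable w μ) (hq0 : ∀ t, 0 < q t) (hqm : Measurable q) (hqi : Integrable q μ)
    (hq1 : ∫ z, q z ∂μ = 1) (n : ℕ) {g : X → ℝ} (hgm : Measurable g) {B : ℝ}
    (hgb : ∀ t, |g t| ≤ B) :
    ∫ x, g x * ((imhOp μ w q)^[n + 1] g) x * w x ∂μ
      = (∫ u in Ioi (0:ℝ), ((n : ℝ) + 1) * rejCurve μ w q u ^ n / u ^ 2
          * (∫ x, (if w x / q x < u then g x * w x else 0) ∂μ) ^ 2)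
        + ∫ x, g x ^ 2 * w x * rejCurve μ w q (w x / q x) ^ (n + 1) ∂μ := by
  have hb0 : ∀ t, 0 < w t / q t := fun t => div_pos (hw0 t) (hq0 t)
  have hbm : Measurable fun t => w t / q t := hwm.div hqm
  have hST := imhOp_iterate_succ_eq hw0 hwm hwi hq0 hqm hqi hq1 n hgm hgb
  have hlam : ∀ x, 0 ≤ rejCurve μ w q (w x / q x) ^ (n + 1)
      ∧ rejCurve μ w q (w x / q x) ^ (n + 1) ≤ 1 := fun x => by
    obtain ⟨h0, h1⟩ := rejCurve_bounds hw0 hq0 hqi (hb0 x) (μ := μ)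
    rw [hq1] at h1
    exact ⟨pow_nonneg h0 _, pow_le_one₀ h0 h1⟩
  -- pointwise Smith–Tierney form
  have e1 : ∀ x, g x * ((imhOp μ w q)^[n + 1] g) x * w x
      = (∫ y, stKernel μ w q n (max (w x / q x) (w y / q y)) * g y * w y * (g x * w x) ∂μ)
        + g x ^ 2 * w x * rejCurve μ w q (w x / q x) ^ (n + 1) := by
    intro x
    rw [hST x]
    have e : ∫ y, stKernel μ w q n (max (w x / q x) (w y / q y)) * g y * w y * (g x * w x) ∂μ
        = (∫ y, stKernel μ w q n (max (w x / q x) (w y / q y)) * g y * w y ∂μ) * (g x * w x) :=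
      MeasureTheory.integral_mul_const _ _
    rw [e]
    ring
  simp_rw [e1]
  have hI1 : Integrable (fun x => ∫ y, stKernel μ w q n (max (w x / q x) (w y / q y)) * g y * w y
      * (g x * w x) ∂μ) μ :=
    (integrable_prod_stKernel_form hw0 hwm hwi hq0 hqm hqi hq1 n hgm hgb).integral_prod_left
  have hI2 : Integrable (fun x => g x ^ 2 * w x * rejCurve μ w q (w x / q x) ^ (n + 1)) μ :=
    integrable_sq_mul_weight_mul hw0 hwm hwi hgm
      (((measurable_rejCurve hwm hqm).comp hbm).pow_const _) hgb (fun x => (hlam x).1)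
      (fun x => (hlam x).2)
  rw [integral_add hI1 hI2, integral_integral_stKernel_eq_sq hw0 hwm hwi hq0 hqm hqi hq1 n hgm hgb]

/-! ## Integrability of the layer-cake integrand on `(0, ∞)` and the partial sums -/

/-- **`φₙ G²` is integrable on `(0, ∞)`**: on `(0, Z]` it is at most `(n+1) B²`
(`|G(u)| ≤ B Π(u⁻) ≤ B u`), on `(Z, ∞)` at most `φₙ(u) (B Z)²` (`Z = ∫ w dμ > 0`). -/
theorem integrableOn_stIntegrand_mul_sq (hw0 : ∀ t, 0 < w t) (hwm : Measurable w)
    (hwi : Integrable w μ) (hq0 : ∀ t, 0 < q t) (hqm : Measurable q) (hqi : Integrable q μ)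
    (hq1 : ∫ z, q z ∂μ = 1) (n : ℕ) {g : X → ℝ} (hgm : Measurable g) {B : ℝ}
    (hgb : ∀ t, |g t| ≤ B) :
    IntegrableOn (fun u : ℝ => ((n : ℝ) + 1) * rejCurve μ w q u ^ n / u ^ 2
      * (∫ x, (if w x / q x < u then g x * w x else 0) ∂μ) ^ 2) (Ioi 0) := by
  set Z : ℝ := ∫ z, w z ∂μ with hZ
  have hZpos : 0 < Z := integral_pos_of_pos hw0 hwi hq1
  have hmeas : Measurable fun u : ℝ => ((n : ℝ) + 1) * rejCurve μ w q u ^ n / u ^ 2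
      * (∫ x, (if w x / q x < u then g x * w x else 0) ∂μ) ^ 2 :=
    (measurable_stIntegrand hwm hqm n).mul ((measurable_levelFun hwm hqm hgm).pow_const 2)
  have hGle : ∀ u, |∫ x, (if w x / q x < u then g x * w x else 0) ∂μ| ≤ B * massBelow μ w q u :=
    fun u => abs_levelFun_le hw0 hwm hwi hqm hgb u
  have hB : ∀ u, 0 ≤ B * massBelow μ w q u := fun u => (abs_nonneg _).trans (hGle u)
  have hsq : ∀ u, (∫ x, (if w x / q x < u then g x * w x else 0) ∂μ) ^ 2
      ≤ (B * massBelow μ w q u) ^ 2 := fun u => by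
    rw [← sq_abs]
    exact pow_le_pow_left₀ (abs_nonneg _) (hGle u) 2
  rw [← Ioc_union_Ioi_eq_Ioi hZpos.le]
  refine IntegrableOn.union ?_ ?_
  · -- `(0, Z]`: bounded integrand on a set of finite measure
    refine Integrable.mono' (integrableOn_const (C := ((n : ℝ) + 1) * B ^ 2)
      (measure_Ioc_lt_top.ne)) hmeas.aestronglyMeasurable ?_
    refine (ae_restrict_iff' measurableSet_Ioc).2 (Eventually.of_forall fun u hu => ?_)
    obtain ⟨h0, h1⟩ := stIntegrand_bounds hw0 hq0 hqi hq1 n hu.1 (μ := μ)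
    have hPu : massBelow μ w q u ≤ u := massBelow_le_self hw0 hwm hwi hq0 hqm hqi hq1 hu.1.le
    have hP0 : 0 ≤ massBelow μ w q u := (massBelow_bounds hw0 hwm hwi hqm u).1
    have hsq' : (B * massBelow μ w q u) ^ 2 ≤ B ^ 2 * u ^ 2 := by
      rw [mul_pow]
      exact mul_le_mul_of_nonneg_left (pow_le_pow_left₀ hP0 hPu 2) (sq_nonneg _)
    rw [Real.norm_eq_abs, abs_mul, abs_of_nonneg h0, abs_of_nonneg (sq_nonneg _)]
    have hu2 : 0 < u ^ 2 := pow_pos hu.1 2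
    have hune : u ≠ 0 := hu.1.ne'
    calc ((n : ℝ) + 1) * rejCurve μ w q u ^ n / u ^ 2
          * (∫ x, (if w x / q x < u then g x * w x else 0) ∂μ) ^ 2
        ≤ ((n : ℝ) + 1) * (1 / u ^ 2) * (B ^ 2 * u ^ 2) :=
          mul_le_mul h1 ((hsq u).trans hsq') (sq_nonneg _) (by positivity)
      _ = ((n : ℝ) + 1) * B ^ 2 := by
          field_simp
  · -- `(Z, ∞)`: dominated by `φₙ (B Z)²`
    refine Integrable.mono' ((integrableOn_stIntegrand hw0 hwm hq0 hqm hqi hq1 n hZpos).mul_const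
      ((B * Z) ^ 2)) hmeas.aestronglyMeasurable ?_
    refine (ae_restrict_iff' measurableSet_Ioi).2 (Eventually.of_forall fun u hu => ?_)
    obtain ⟨h0, -⟩ := stIntegrand_bounds hw0 hq0 hqi hq1 n (hZpos.trans hu) (μ := μ)
    have hPZ : massBelow μ w q u ≤ Z := by
      obtain ⟨-, h1, h2⟩ := massBelow_bounds hw0 hwm hwi hqm u (μ := μ)
      exact h1.trans h2
    have hP0 : 0 ≤ massBelow μ w q u := (massBelow_bounds hw0 hwm hwi hqm u).1
    have hsq' : (B * massBelow μ w q u) ^ 2 ≤ (B * Z) ^ 2 := by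
      rw [mul_pow, mul_pow]
      exact mul_le_mul_of_nonneg_left (pow_le_pow_left₀ hP0 hPZ 2) (sq_nonneg _)
    rw [Real.norm_eq_abs, abs_mul, abs_of_nonneg h0, abs_of_nonneg (sq_nonneg _)]
    exact mul_le_mul_of_nonneg_left ((hsq u).trans hsq') h0

/-- **PARTIAL GREEN–KUBO SUMS IN LAYER-CAKE FORM.**  For every `N`:
`Σ_{k<N} ∫ g (K^{k+1} g) w dμ
   = ∫_{u>0} (Σ_{k<N} (k+1)λ(u)ᵏ)/u² · (∫ 1[b < u] g w dμ)² du + ∫ g² w Σ_{k<N} λ(b)^{k+1} dμ`. -/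
theorem autocov_partialSum_eq_layerCake (hw0 : ∀ t, 0 < w t) (hwm : Measurable w)
    (hwi : Integrable w μ) (hq0 : ∀ t, 0 < q t) (hqm : Measurable q) (hqi : Integrable q μ)
    (hq1 : ∫ z, q z ∂μ = 1) {g : X → ℝ} (hgm : Measurable g) {B : ℝ} (hgb : ∀ t, |g t| ≤ B)
    (N : ℕ) :
    ∑ k ∈ Finset.range N, ∫ x, g x * ((imhOp μ w q)^[k + 1] g) x * w x ∂μ
      = (∫ u in Ioi (0:ℝ), (∑ k ∈ Finset.range N, ((k : ℝ) + 1) * rejCurve μ w q u ^ k) / u ^ 2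
          * (∫ x, (if w x / q x < u then g x * w x else 0) ∂μ) ^ 2)
        + ∫ x, g x ^ 2 * w x
          * ∑ k ∈ Finset.range N, rejCurve μ w q (w x / q x) ^ (k + 1) ∂μ := by
  have hb0 : ∀ t, 0 < w t / q t := fun t => div_pos (hw0 t) (hq0 t)
  have hbm : Measurable fun t => w t / q t := hwm.div hqm
  have hlam : ∀ x k, 0 ≤ rejCurve μ w q (w x / q x) ^ (k + 1)
      ∧ rejCurve μ w q (w x / q x) ^ (k + 1) ≤ 1 := fun x k => by
    obtain ⟨h0, h1⟩ := rejCurve_bounds hw0 hq0 hqi (hb0 x) (μ := μ)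
    rw [hq1] at h1
    exact ⟨pow_nonneg h0 _, pow_le_one₀ h0 h1⟩
  have hI2 : ∀ k, Integrable (fun x => g x ^ 2 * w x * rejCurve μ w q (w x / q x) ^ (k + 1)) μ :=
    fun k => integrable_sq_mul_weight_mul hw0 hwm hwi hgm
      (((measurable_rejCurve hwm hqm).comp hbm).pow_const _) hgb (fun x => (hlam x k).1)
      (fun x => (hlam x k).2)
  rw [Finset.sum_congr rfl fun k _ =>
    autocov_succ_eq_layerCake hw0 hwm hwi hq0 hqm hqi hq1 k hgm hgb, Finset.sum_add_distrib]
  have h1 : ∫ u in Ioi (0:ℝ), ∑ k ∈ Finset.range N, ((k : ℝ) + 1) * rejCurve μ w q u ^ k / u ^ 2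
        * (∫ x, (if w x / q x < u then g x * w x else 0) ∂μ) ^ 2
      = ∑ k ∈ Finset.range N, ∫ u in Ioi (0:ℝ), ((k : ℝ) + 1) * rejCurve μ w q u ^ k / u ^ 2
        * (∫ x, (if w x / q x < u then g x * w x else 0) ∂μ) ^ 2 :=
    integral_finsetSum _ fun k _ =>
      integrableOn_stIntegrand_mul_sq hw0 hwm hwi hq0 hqm hqi hq1 k hgm hgb
  have h2 : ∫ x, ∑ k ∈ Finset.range N, g x ^ 2 * w x * rejCurve μ w q (w x / q x) ^ (k + 1) ∂μ
      = ∑ k ∈ Finset.range N, ∫ x, g x ^ 2 * w x * rejCurve μ w q (w x / q x) ^ (k + 1) ∂μ :=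
    integral_finsetSum _ fun k _ => hI2 k
  rw [← h1, ← h2]
  congr 1
  · refine integral_congr_ae (Eventually.of_forall fun u => ?_)
    show ∑ k ∈ Finset.range N, ((k : ℝ) + 1) * rejCurve μ w q u ^ k / u ^ 2
        * (∫ x, (if w x / q x < u then g x * w x else 0) ∂μ) ^ 2
      = (∑ k ∈ Finset.range N, ((k : ℝ) + 1) * rejCurve μ w q u ^ k) / u ^ 2
        * (∫ x, (if w x / q x < u then g x * w x else 0) ∂μ) ^ 2
    rw [Finset.sum_div, Finset.sum_mul]
  · refine integral_congr_ae (Eventually.of_forall fun x => ?_)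
    show ∑ k ∈ Finset.range N, g x ^ 2 * w x * rejCurve μ w q (w x / q x) ^ (k + 1)
      = g x ^ 2 * w x * ∑ k ∈ Finset.range N, rejCurve μ w q (w x / q x) ^ (k + 1)
    rw [Finset.mul_sum]

end Summit.Ventures.LatticeQCDFlow.Exactness
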